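import Mathlib
import HarnessLib

/-!
# ValiantsHypothesis / LacunarySymmetroid — crux `MatrixDescartes` (stmt-ValiantsHypothesis-18050, V1), LINE (A) «product_plus_one»,
# research stubs `stub_classRowK3` / `stub_eulerBoundK3`: the MIDDLE COUPLING for rows with POSITIVE OUTER LETTERS —
# Euler-letter sign law, localisation between the extreme outer bottoms, and the COMMON-OUTER-RATIO FACTORISATION (`Z₊ = 1`, every `m`)

The c-free Euler numerator of the line at coupling `l₀` is `E = Σ_j B_j · ∏_{i≠j} f_i` with the Euler letters
`B_j = Σ_l a_{jl}(d_l − d_{l₀}) X^{d_l}` (`Cruxes/MatrixDescartes/Lines/product_plus_one.lean`, `eulerNumerator`; stated here UNFOLDED, verbatim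
as in ✓ `ProductPlusOne.eulerNumerator_eq_general` / ✓ `ZeroChange.card_posRoots_euler_bottom_eq_posCrit`).  The tree treats the middle coupling
`l₀ = 1` only for NO-DIP rows `a_{j0}a_{j2} < 0` (✓ `…ProductPlusOneMiddleLaurent`: one-signed middle letters; ✓ `…ABWindowMiddle`, ✓ `…WeakMiddle`);
the S4′ residue names «the middle coupling» (skeleton docstring of `stub_classRowK3`).  This file treats the complementary cell — rows with
POSITIVE OUTER LETTERS `a_{j0} > 0`, `a_{j2} > 0` and an ARBITRARY middle letter (zero-change rows `(+,+,+)` AND two-change valley rows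
`(+,−,+)` alike) — where the middle Euler letter `B_j = x^{d₀}·(−(d₁−d₀)a_{j0} + (d₂−d₁)a_{j2}x^{d₂−d₀})` is NOT one-signed but has exactly
one positive zero, the OUTER BOTTOM `x_j` (`x_j^{d₂−d₀} = (d₁−d₀)a_{j0}/((d₂−d₁)a_{j2})`), which does not see the middle letter at all:

* `eval_euler_unfolded` / `euler_eval_pos_of_letters_pos` / `_neg_of_letters_neg` / `_eq_zero_of_letters_eq_zero` — EVERY format `K`, every
  coupling: where all factors are positive, the sign of `E(x)` is forced as soon as all Euler letters have one strict sign at `x` (no division,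
  `E = Σ_j B_j ∏_{i≠j} f_i` termwise);
* `eval_eulerLetter_middle` / `middleBracket_lt` — `K = 3`, `l₀ = 1`: the letter is `x^{d₀}` times the OUTER BRACKET, strictly increasing for `a_{j2} > 0`;
* ★ `euler_middle_roots_between_outer_bottoms` — **LOCALISATION**: positive top letters, factors zero-free on `(0,∞)`: if all outer brackets are
  `≤ 0` at `τ₁` and `≥ 0` at `τ₂`, every positive root of `E` lies in `[τ₁, τ₂]` (between the extreme outer bottoms), every `m`, every support;
* ★★ `euler_middle_eq_bracket_mul_of_outerRatio` — **COMMON-OUTER-RATIO FACTORISATION** (pure algebra, ANY letters otherwise, factors may vanish):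
  `a_{j0} = κ·a_{j2}` for all `j` ⇒ `E = (C(−(d₁−d₀)κ)·X^{d₀} + C(d₂−d₁)·X^{d₂}) · Σ_j C(a_{j2}) ∏_{i≠j} f_i`;
* ★★ `euler_middle_card_posRoots_le_one_of_outerRatio` / `…_eq_one_of_outerRatio` — **COMMON-OUTER-RATIO LAW**: such a company with `κ > 0`,
  `a_{j2} > 0` and zero-free factors has EXACTLY ONE positive Euler root at the middle coupling (`m ≥ 1`; `≤ 1` for every `m`) — for every `m`,
  every support `d₀ < d₁ < d₂`, and ARBITRARY middle letters `a_{j1}` (e.g. all rows `x^{d₀}·(1 + b_j x^{d₁−d₀} + x^{d₂−d₀})`, `b_j > −2`…);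
* `euler_bottom_eq_bracket_mul_of_middleTopRatio` — the bottom-coupling twin of the factorisation (`a_{j1} = −κ·a_{j2}`), which explains
  ✓ `ZeroChange.euler_bottom_eq_one_of_commonBottom` (✓ `…ZeroChangeValleyBottoms`) algebraically and extends it to factors with zeros:
  `Z₊(E) ≤ 1 + Z₊(Σ_j a_{j2}∏_{i≠j} f_i)` is what remains there.

HONEST FRAMING: helper / sector theorems, def-free, no named facts, no `sorry`, standard axioms; closes NO stub by name; `OneChangeFloorK3`,
`EulerBoundK3`, `ClassRowK3Linear`, `PPOPolyLaw`, `MatrixDescartes` (stmt-ValiantsHypothesis-18050) stay OPEN; `VP ≠ VNP` is NOT proved and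
nothing here bears on it.  [folklore] Elementary algebra of sparse polynomials; no citation needed.
-/

set_option linter.dupNamespace false

namespace Summit.ValiantsHypothesis.ValiantsHypothesis.Theorems.LacunarySymmetroidMatrixDescartes

namespace ProductPlusOne

open Polynomial Finset
open scoped BigOperators

/-! ## §1 Every format, every coupling: the unfolded Euler numerator termwise -/

/-- Evaluation of the unfolded c-free Euler numerator: `E(x) = Σ_j B_j(x) · ∏_{i≠j} f_i(x)`. [folklore] -/
theorem eval_euler_unfolded {m K : ℕ} (d : Fin K → ℕ) (a : Fin m → Fin K → ℝ) (l₀ : Fin K) (x : ℝ) :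
    ((∑ j, (∑ l, C (a j l * ((d l : ℝ) - d l₀)) * X ^ (d l)) * ∏ i ∈ Finset.univ.erase j, (∑ l, C (a i l) * X ^ (d l)) : ℝ[X])).eval x
      = ∑ j, (∑ l, a j l * ((d l : ℝ) - d l₀) * x ^ (d l)) * ∏ i ∈ Finset.univ.erase j, (∑ l, a i l * x ^ (d l)) := by
  simp [eval_finsetSum, eval_prod]

/-- **SIGN LAW (positive)**: at `x`, if every factor is positive and every Euler letter is positive, then `E(x) > 0` (`m ≥ 1`). [folklore] -/
theorem euler_eval_pos_of_letters_pos {m K : ℕ} (hm : 0 < m) (d : Fin K → ℕ) (a : Fin m → Fin K → ℝ) (l₀ : Fin K) {x : ℝ}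
    (hf : ∀ i, 0 < ∑ l, a i l * x ^ (d l)) (hB : ∀ j, 0 < ∑ l, a j l * ((d l : ℝ) - d l₀) * x ^ (d l)) :
    0 < ((∑ j, (∑ l, C (a j l * ((d l : ℝ) - d l₀)) * X ^ (d l)) * ∏ i ∈ Finset.univ.erase j, (∑ l, C (a i l) * X ^ (d l))
      : ℝ[X])).eval x := by
  rw [eval_euler_unfolded]
  have hterm : ∀ j ∈ (univ : Finset (Fin m)), 0 < (∑ l, a j l * ((d l : ℝ) - d l₀) * x ^ (d l)) *
      ∏ i ∈ Finset.univ.erase j, (∑ l, a i l * x ^ (d l)) :=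
    fun j _ => mul_pos (hB j) (prod_pos fun i _ => hf i)
  haveI : Nonempty (Fin m) := ⟨⟨0, hm⟩⟩
  exact sum_pos hterm univ_nonempty

/-- **SIGN LAW (negative)**: every factor positive and every Euler letter negative at `x` ⇒ `E(x) < 0` (`m ≥ 1`). [folklore] -/
theorem euler_eval_neg_of_letters_neg {m K : ℕ} (hm : 0 < m) (d : Fin K → ℕ) (a : Fin m → Fin K → ℝ) (l₀ : Fin K) {x : ℝ}
    (hf : ∀ i, 0 < ∑ l, a i l * x ^ (d l)) (hB : ∀ j, ∑ l, a j l * ((d l : ℝ) - d l₀) * x ^ (d l) < 0) :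
    ((∑ j, (∑ l, C (a j l * ((d l : ℝ) - d l₀)) * X ^ (d l)) * ∏ i ∈ Finset.univ.erase j, (∑ l, C (a i l) * X ^ (d l))
      : ℝ[X])).eval x < 0 := by
  rw [eval_euler_unfolded]
  have hterm : ∀ j ∈ (univ : Finset (Fin m)), (∑ l, a j l * ((d l : ℝ) - d l₀) * x ^ (d l)) *
      ∏ i ∈ Finset.univ.erase j, (∑ l, a i l * x ^ (d l)) < 0 :=
    fun j _ => mul_neg_of_neg_of_pos (hB j) (prod_pos fun i _ => hf i)
  haveI : Nonempty (Fin m) := ⟨⟨0, hm⟩⟩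
  exact sum_neg hterm univ_nonempty

/-- **SIGN LAW (zero)**: if every Euler letter vanishes at `x` then `E(x) = 0` (factors arbitrary). [folklore] -/
theorem euler_eval_eq_zero_of_letters_eq_zero {m K : ℕ} (d : Fin K → ℕ) (a : Fin m → Fin K → ℝ) (l₀ : Fin K) {x : ℝ}
    (hB : ∀ j, ∑ l, a j l * ((d l : ℝ) - d l₀) * x ^ (d l) = 0) :
    ((∑ j, (∑ l, C (a j l * ((d l : ℝ) - d l₀)) * X ^ (d l)) * ∏ i ∈ Finset.univ.erase j, (∑ l, C (a i l) * X ^ (d l))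
      : ℝ[X])).eval x = 0 := by
  rw [eval_euler_unfolded]
  exact sum_eq_zero fun j _ => by rw [hB j, zero_mul]

/-! ## §2 `K = 3`, middle coupling: the Euler letter is `x^{d₀}` times the OUTER BRACKET -/

/-- The middle Euler letter of a trinomial row: `B_j(x) = x^{d₀}·(−(d₁−d₀)·a_{j0} + (d₂−d₁)·a_{j2}·x^{d₂−d₀})` (`d₀ ≤ d₂`; the middle letter
`a_{j1}` does not occur). [folklore] -/
theorem eval_eulerLetter_middle (d : Fin 3 → ℕ) (h02 : d 0 ≤ d 2) (b : Fin 3 → ℝ) (x : ℝ) :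
    ∑ l, b l * ((d l : ℝ) - d 1) * x ^ (d l)
      = x ^ (d 0) * (-(((d 1 : ℝ) - d 0) * b 0) + ((d 2 : ℝ) - d 1) * b 2 * x ^ (d 2 - d 0)) := by
  rw [Fin.sum_univ_three]
  have h : x ^ (d 2) = x ^ (d 0) * x ^ (d 2 - d 0) := by rw [← pow_add, Nat.add_sub_cancel' h02]
  rw [h]
  ring

/-- The outer bracket `−(d₁−d₀)·a₀ + (d₂−d₁)·a₂·x^{d₂−d₀}` is strictly increasing on `[0,∞)` when `a₂ > 0` (`d₀ < d₁ < d₂`). [folklore] -/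
theorem middleBracket_lt (d : Fin 3 → ℕ) (h01 : d 0 < d 1) (h12 : d 1 < d 2) (b0 : ℝ) {b2 : ℝ} (hb2 : 0 < b2) {x y : ℝ}
    (hx : 0 ≤ x) (hxy : x < y) :
    -(((d 1 : ℝ) - d 0) * b0) + ((d 2 : ℝ) - d 1) * b2 * x ^ (d 2 - d 0)
      < -(((d 1 : ℝ) - d 0) * b0) + ((d 2 : ℝ) - d 1) * b2 * y ^ (d 2 - d 0) := by
  have hw : (0 : ℝ) < (d 2 : ℝ) - d 1 := by
    have : (d 1 : ℝ) < d 2 := by exact_mod_cast h12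
    linarith
  have hpow : x ^ (d 2 - d 0) < y ^ (d 2 - d 0) := pow_lt_pow_left₀ hxy hx (by omega)
  linarith [mul_lt_mul_of_pos_left hpow (mul_pos hw hb2)]

/-- The outer bottom is unique: two positive zeros of the outer bracket coincide (`a₂ > 0`). [folklore] -/
theorem middleBracket_root_unique (d : Fin 3 → ℕ) (h01 : d 0 < d 1) (h12 : d 1 < d 2) (b0 : ℝ) {b2 : ℝ} (hb2 : 0 < b2)
    {x y : ℝ} (hx : 0 < x) (hy : 0 < y)
    (hxr : -(((d 1 : ℝ) - d 0) * b0) + ((d 2 : ℝ) - d 1) * b2 * x ^ (d 2 - d 0) = 0)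
    (hyr : -(((d 1 : ℝ) - d 0) * b0) + ((d 2 : ℝ) - d 1) * b2 * y ^ (d 2 - d 0) = 0) : x = y := by
  rcases lt_trichotomy x y with hlt | heq | hgt
  · linarith [middleBracket_lt d h01 h12 b0 hb2 hx.le hlt]
  · exact heq
  · linarith [middleBracket_lt d h01 h12 b0 hb2 hy.le hgt]

/-- Existence of the outer bottom: for `a₀, a₂ > 0` the outer bracket has a positive zero `x`, `x^{d₂−d₀} = (d₁−d₀)a₀/((d₂−d₁)a₂)`. [folklore] -/
theorem exists_middleBracket_root (d : Fin 3 → ℕ) (h01 : d 0 < d 1) (h12 : d 1 < d 2) {b0 b2 : ℝ} (hb0 : 0 < b0) (hb2 : 0 < b2) :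
    ∃ x : ℝ, 0 < x ∧ -(((d 1 : ℝ) - d 0) * b0) + ((d 2 : ℝ) - d 1) * b2 * x ^ (d 2 - d 0) = 0 := by
  have hw1 : (0 : ℝ) < (d 1 : ℝ) - d 0 := by
    have : (d 0 : ℝ) < d 1 := by exact_mod_cast h01
    linarith
  have hw2 : (0 : ℝ) < (d 2 : ℝ) - d 1 := by
    have : (d 1 : ℝ) < d 2 := by exact_mod_cast h12
    linarith
  set y : ℝ := ((d 1 : ℝ) - d 0) * b0 / (((d 2 : ℝ) - d 1) * b2) with hy
  have hypos : 0 < y := div_pos (mul_pos hw1 hb0) (mul_pos hw2 hb2)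
  have hne : d 2 - d 0 ≠ 0 := by omega
  refine ⟨y ^ ((d 2 - d 0 : ℕ) : ℝ)⁻¹, Real.rpow_pos_of_pos hypos _, ?_⟩
  rw [Real.rpow_inv_natCast_pow hypos.le hne, hy]
  field_simp
  ring

/-! ## §3 Localisation of the middle-coupling Euler roots between the extreme outer bottoms -/

/-- ★ **LOCALISATION AT THE MIDDLE COUPLING**: `K = 3`, `d₀ < d₁ < d₂`, positive top letters `a_{j2} > 0`, factors zero-free on `(0,∞)`;
if every outer bracket is `≤ 0` at `τ₁` and `≥ 0` at `τ₂ > 0`, then every positive root of the middle-coupling Euler numerator lies in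
`[τ₁, τ₂]` — every `m`, no ratio window, middle letters arbitrary. [folklore] -/
theorem euler_middle_roots_between_outer_bottoms {m : ℕ} (d : Fin 3 → ℕ) (h01 : d 0 < d 1) (h12 : d 1 < d 2)
    (a : Fin m → Fin 3 → ℝ) (htop : ∀ j, 0 < a j 2)
    (hpos : ∀ i, ∀ x : ℝ, 0 < x → 0 < ∑ l, a i l * x ^ (d l))
    {τ₁ τ₂ : ℝ} (hτ₂ : 0 < τ₂)
    (h₁ : ∀ j, -(((d 1 : ℝ) - d 0) * a j 0) + ((d 2 : ℝ) - d 1) * a j 2 * τ₁ ^ (d 2 - d 0) ≤ 0)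
    (h₂ : ∀ j, 0 ≤ -(((d 1 : ℝ) - d 0) * a j 0) + ((d 2 : ℝ) - d 1) * a j 2 * τ₂ ^ (d 2 - d 0)) :
    ∀ x ∈ ((∑ j, (∑ l, C (a j l * ((d l : ℝ) - d 1)) * X ^ (d l)) * ∏ i ∈ Finset.univ.erase j, (∑ l, C (a i l) * X ^ (d l))
        : ℝ[X]).roots.toFinset.filter (fun t => 0 < t)), τ₁ ≤ x ∧ x ≤ τ₂ := by
  classical
  intro x hx
  simp only [mem_filter, Multiset.mem_toFinset] at hx
  obtain ⟨hroot, hxpos⟩ := hx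
  have hne := (mem_roots'.1 hroot).1
  have hE : ((∑ j, (∑ l, C (a j l * ((d l : ℝ) - d 1)) * X ^ (d l)) * ∏ i ∈ Finset.univ.erase j, (∑ l, C (a i l) * X ^ (d l))
      : ℝ[X])).eval x = 0 := (mem_roots'.1 hroot).2
  have hm : 0 < m := by
    rcases Nat.eq_zero_or_pos m with rfl | hm
    · exact absurd (by simp) hne
    · exact hm
  have h02 : d 0 ≤ d 2 := by omega
  have hxd : 0 < x ^ (d 0) := pow_pos hxpos _
  constructor
  · by_contra hlt
    push Not at hlt
    have hB : ∀ j, ∑ l, a j l * ((d l : ℝ) - d 1) * x ^ (d l) < 0 := by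
      intro j
      rw [eval_eulerLetter_middle d h02]
      refine mul_neg_of_pos_of_neg hxd ?_
      exact lt_of_lt_of_le (middleBracket_lt d h01 h12 (a j 0) (htop j) hxpos.le hlt) (h₁ j)
    exact (euler_eval_neg_of_letters_neg hm d a 1 (fun i => hpos i x hxpos) hB).ne hE
  · by_contra hlt
    push Not at hlt
    have hB : ∀ j, 0 < ∑ l, a j l * ((d l : ℝ) - d 1) * x ^ (d l) := by
      intro j
      rw [eval_eulerLetter_middle d h02]
      refine mul_pos hxd ?_
      exact lt_of_le_of_lt (h₂ j) (middleBracket_lt d h01 h12 (a j 0) (htop j) hτ₂.le hlt)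
    exact (euler_eval_pos_of_letters_pos hm d a 1 (fun i => hpos i x hxpos) hB).ne' hE

/-! ## §4 The common-outer-ratio factorisation and the exact count -/

/-- ★★ **COMMON-OUTER-RATIO FACTORISATION** (pure algebra): if `a_{j0} = κ·a_{j2}` for every row, the middle-coupling Euler numerator is
the BINOMIAL `C(−(d₁−d₀)κ)·X^{d₀} + C(d₂−d₁)·X^{d₂}` times `Σ_j C(a_{j2})·∏_{i≠j} f_i` — any `κ`, any middle letters, factors may vanish. [folklore] -/
theorem euler_middle_eq_bracket_mul_of_outerRatio {m : ℕ} (d : Fin 3 → ℕ) (a : Fin m → Fin 3 → ℝ) (κ : ℝ)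
    (hratio : ∀ j, a j 0 = κ * a j 2) :
    ((∑ j, (∑ l, C (a j l * ((d l : ℝ) - d 1)) * X ^ (d l)) * ∏ i ∈ Finset.univ.erase j, (∑ l, C (a i l) * X ^ (d l)) : ℝ[X]))
      = (C (-(((d 1 : ℝ) - d 0) * κ)) * X ^ (d 0) + C ((d 2 : ℝ) - d 1) * X ^ (d 2)) *
          ∑ j, C (a j 2) * ∏ i ∈ Finset.univ.erase j, (∑ l, C (a i l) * X ^ (d l)) := by
  classical
  rw [mul_sum]
  refine sum_congr rfl fun j _ => ?_
  have hletter : (∑ l, C (a j l * ((d l : ℝ) - d 1)) * X ^ (d l) : ℝ[X])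
      = (C (-(((d 1 : ℝ) - d 0) * κ)) * X ^ (d 0) + C ((d 2 : ℝ) - d 1) * X ^ (d 2)) * C (a j 2) := by
    rw [Fin.sum_univ_three, hratio j]
    simp only [C_mul, C_sub, C_neg]
    ring
  rw [hletter, mul_assoc]

/-- the bottom-coupling twin: a common MIDDLE-to-TOP ratio `a_{j1} = −κ·a_{j2}` factors the bottom-coupling Euler numerator through the
binomial `C(−(d₁−d₀)κ)·X^{d₁} + C(d₂−d₀)·X^{d₂}` (algebraic form of ✓ `ZeroChange.euler_bottom_eq_one_of_commonBottom`; factors may vanish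
here, so in general `Z₊ ≤ 1 + Z₊(Σ_j a_{j2}∏_{i≠j} f_i)`). [folklore] -/
theorem euler_bottom_eq_bracket_mul_of_middleTopRatio {m : ℕ} (d : Fin 3 → ℕ) (a : Fin m → Fin 3 → ℝ) (κ : ℝ)
    (hratio : ∀ j, a j 1 = -κ * a j 2) :
    ((∑ j, (∑ l, C (a j l * ((d l : ℝ) - d 0)) * X ^ (d l)) * ∏ i ∈ Finset.univ.erase j, (∑ l, C (a i l) * X ^ (d l)) : ℝ[X]))
      = (C (-(((d 1 : ℝ) - d 0) * κ)) * X ^ (d 1) + C ((d 2 : ℝ) - d 0) * X ^ (d 2)) *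
          ∑ j, C (a j 2) * ∏ i ∈ Finset.univ.erase j, (∑ l, C (a i l) * X ^ (d l)) := by
  classical
  rw [mul_sum]
  refine sum_congr rfl fun j _ => ?_
  have hletter : (∑ l, C (a j l * ((d l : ℝ) - d 0)) * X ^ (d l) : ℝ[X])
      = (C (-(((d 1 : ℝ) - d 0) * κ)) * X ^ (d 1) + C ((d 2 : ℝ) - d 0) * X ^ (d 2)) * C (a j 2) := by
    rw [Fin.sum_univ_three, hratio j]
    simp only [C_mul, C_sub, C_neg]
    ring
  rw [hletter, mul_assoc]

/-- The companion sum `Σ_j a_{j2}·∏_{i≠j} f_i(x)` is positive where all factors are positive and the top letters are (`m ≥ 1`). [folklore] -/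
theorem eval_topWeightedSum_pos {m : ℕ} (hm : 0 < m) (d : Fin 3 → ℕ) (a : Fin m → Fin 3 → ℝ) (htop : ∀ j, 0 < a j 2) {x : ℝ}
    (hf : ∀ i, 0 < ∑ l, a i l * x ^ (d l)) :
    0 < (∑ j, C (a j 2) * ∏ i ∈ Finset.univ.erase j, (∑ l, C (a i l) * X ^ (d l)) : ℝ[X]).eval x := by
  classical
  have hev : (∑ j, C (a j 2) * ∏ i ∈ Finset.univ.erase j, (∑ l, C (a i l) * X ^ (d l)) : ℝ[X]).eval x
      = ∑ j, a j 2 * ∏ i ∈ Finset.univ.erase j, (∑ l, a i l * x ^ (d l)) := by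
    simp [eval_finsetSum, eval_prod]
  rw [hev]
  haveI : Nonempty (Fin m) := ⟨⟨0, hm⟩⟩
  exact sum_pos (fun j _ => mul_pos (htop j) (prod_pos fun i _ => hf i)) univ_nonempty

/-- ★★ **COMMON-OUTER-RATIO LAW (upper bound)**: `d₀ < d₁ < d₂`, `a_{j0} = κ·a_{j2}` with `a_{j2} > 0`, factors zero-free on `(0,∞)` ⇒ the
middle-coupling Euler numerator has AT MOST ONE positive root — every `m`, ARBITRARY middle letters. [folklore] -/
theorem euler_middle_card_posRoots_le_one_of_outerRatio {m : ℕ} (d : Fin 3 → ℕ) (h01 : d 0 < d 1) (h12 : d 1 < d 2)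
    (a : Fin m → Fin 3 → ℝ) (htop : ∀ j, 0 < a j 2) (κ : ℝ) (hratio : ∀ j, a j 0 = κ * a j 2)
    (hpos : ∀ i, ∀ x : ℝ, 0 < x → 0 < ∑ l, a i l * x ^ (d l)) :
    ((∑ j, (∑ l, C (a j l * ((d l : ℝ) - d 1)) * X ^ (d l)) * ∏ i ∈ Finset.univ.erase j, (∑ l, C (a i l) * X ^ (d l))
        : ℝ[X]).roots.toFinset.filter (fun t => 0 < t)).card ≤ 1 := by
  classical
  rcases Nat.eq_zero_or_pos m with rfl | hm
  · simp
  -- positive roots of `E` are positive zeros of the outer bracket (the companion sum is positive there)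
  have key : ∀ x : ℝ, 0 < x →
      ((∑ j, (∑ l, C (a j l * ((d l : ℝ) - d 1)) * X ^ (d l)) * ∏ i ∈ Finset.univ.erase j, (∑ l, C (a i l) * X ^ (d l))
        : ℝ[X])).eval x = 0 →
      -(((d 1 : ℝ) - d 0) * κ) + ((d 2 : ℝ) - d 1) * 1 * x ^ (d 2 - d 0) = 0 := by
    intro x hx hE
    rw [euler_middle_eq_bracket_mul_of_outerRatio d a κ hratio, eval_mul] at hE
    have hS := eval_topWeightedSum_pos hm d a htop (hpos · x hx)
    have hb : (C (-(((d 1 : ℝ) - d 0) * κ)) * X ^ (d 0) + C ((d 2 : ℝ) - d 1) * X ^ (d 2) : ℝ[X]).eval x = 0 :=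
      (mul_eq_zero.1 hE).resolve_right hS.ne'
    have h02 : d 0 ≤ d 2 := by omega
    have hx0 : x ^ (d 0) ≠ 0 := pow_ne_zero _ hx.ne'
    have hev : (C (-(((d 1 : ℝ) - d 0) * κ)) * X ^ (d 0) + C ((d 2 : ℝ) - d 1) * X ^ (d 2) : ℝ[X]).eval x
        = x ^ (d 0) * (-(((d 1 : ℝ) - d 0) * κ) + ((d 2 : ℝ) - d 1) * 1 * x ^ (d 2 - d 0)) := by
      simp only [eval_add, eval_mul, eval_C, eval_pow, eval_X]
      rw [show x ^ (d 2) = x ^ (d 0) * x ^ (d 2 - d 0) by rw [← pow_add, Nat.add_sub_cancel' h02]]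
      ring
    rw [hev] at hb
    exact (mul_eq_zero.1 hb).resolve_left hx0
  refine card_le_one.2 fun x hx y hy => ?_
  simp only [mem_filter, Multiset.mem_toFinset] at hx hy
  exact middleBracket_root_unique d h01 h12 κ one_pos hx.2 hy.2 (key x hx.2 (mem_roots'.1 hx.1).2)
    (key y hy.2 (mem_roots'.1 hy.1).2)

/-- ★★ **COMMON-OUTER-RATIO LAW (exact)**: as above with `m ≥ 1` and `κ > 0`: EXACTLY ONE positive root (the common outer bottom). [folklore] -/
theorem euler_middle_card_posRoots_eq_one_of_outerRatio {m : ℕ} (hm : 0 < m) (d : Fin 3 → ℕ) (h01 : d 0 < d 1) (h12 : d 1 < d 2)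
    (a : Fin m → Fin 3 → ℝ) (htop : ∀ j, 0 < a j 2) {κ : ℝ} (hκ : 0 < κ) (hratio : ∀ j, a j 0 = κ * a j 2)
    (hpos : ∀ i, ∀ x : ℝ, 0 < x → 0 < ∑ l, a i l * x ^ (d l)) :
    ((∑ j, (∑ l, C (a j l * ((d l : ℝ) - d 1)) * X ^ (d l)) * ∏ i ∈ Finset.univ.erase j, (∑ l, C (a i l) * X ^ (d l))
        : ℝ[X]).roots.toFinset.filter (fun t => 0 < t)).card = 1 := by
  classical
  refine le_antisymm (euler_middle_card_posRoots_le_one_of_outerRatio d h01 h12 a htop κ hratio hpos) ?_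
  obtain ⟨x₀, hx₀, hbx₀⟩ := exists_middleBracket_root d h01 h12 hκ one_pos
  have h02 : d 0 ≤ d 2 := by omega
  -- every Euler letter vanishes at the common outer bottom
  have hB0 : ∀ j, ∑ l, a j l * ((d l : ℝ) - d 1) * x₀ ^ (d l) = 0 := by
    intro j
    rw [eval_eulerLetter_middle d h02, hratio j]
    have : -(((d 1 : ℝ) - d 0) * (κ * a j 2)) + ((d 2 : ℝ) - d 1) * a j 2 * x₀ ^ (d 2 - d 0)
        = a j 2 * (-(((d 1 : ℝ) - d 0) * κ) + ((d 2 : ℝ) - d 1) * 1 * x₀ ^ (d 2 - d 0)) := by ring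
    rw [this, hbx₀, mul_zero, mul_zero]
  have hE0 := euler_eval_eq_zero_of_letters_eq_zero d a 1 hB0
  -- `E` is not the zero polynomial: it is positive beyond the bottom
  have hx1 : 0 < x₀ + 1 := by linarith
  have hne : ((∑ j, (∑ l, C (a j l * ((d l : ℝ) - d 1)) * X ^ (d l)) * ∏ i ∈ Finset.univ.erase j, (∑ l, C (a i l) * X ^ (d l))
      : ℝ[X])) ≠ 0 := by
    intro h0
    have hB : ∀ j, 0 < ∑ l, a j l * ((d l : ℝ) - d 1) * (x₀ + 1) ^ (d l) := by
      intro j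
      rw [eval_eulerLetter_middle d h02, hratio j]
      refine mul_pos (pow_pos hx1 _) ?_
      have hlt := middleBracket_lt d h01 h12 κ one_pos hx₀.le (show x₀ < x₀ + 1 by linarith)
      have : -(((d 1 : ℝ) - d 0) * (κ * a j 2)) + ((d 2 : ℝ) - d 1) * a j 2 * (x₀ + 1) ^ (d 2 - d 0)
          = a j 2 * (-(((d 1 : ℝ) - d 0) * κ) + ((d 2 : ℝ) - d 1) * 1 * (x₀ + 1) ^ (d 2 - d 0)) := by ring
      rw [this]
      exact mul_pos (htop j) (by linarith)
    have h1 := euler_eval_pos_of_letters_pos hm d a 1 (fun i => hpos i _ hx1) hB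
    rw [h0, eval_zero] at h1
    exact lt_irrefl _ h1
  refine one_le_card.2 ⟨x₀, ?_⟩
  simp only [mem_filter, Multiset.mem_toFinset]
  exact ⟨(mem_roots hne).2 hE0, hx₀⟩

end ProductPlusOne

end Summit.ValiantsHypothesis.ValiantsHypothesis.Theorems.LacunarySymmetroidMatrixDescartes
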